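import Literature.AnabelianGeometry.EtaleTheta.Discharge.Sec2Def21OfSection
import Literature.AnabelianGeometry.EtaleTheta.Discharge.Sec2HuuEigenSplitting
import HarnessLib

/-!
# [EtTh] §2 at the §1 model, FROM A CHOSEN `X̲̲` and a SECTION (no cusp, no hIx): the `(−1)`-eigenspace,
# the splitting `S := Π_{X̲̲} ∩ (D̄_x-preimage·Ker)` and an inversion of order `2` normalising `Π_{X̲̲}` (proof-only)

S. Mochizuki, *The étale theta function and its Frobenioid-theoretic manifestations*, Publ. RIMS **45** (2009) [EtTh], §2:
Def. 2.1 p. 36, Prop. 2.2 (i)–(iii) pp. 36–38, Def. 2.3 p. 38, Def. 2.5 (i) p. 39 [cite: MochizukiEtTh2009, Prop 2.2 (ii) p.37].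
Cell abc-iut, layer L2, seat abc-iut-L2-t10 (gen 6) — `coverDataAx` constructor lineage, row «OFHUU-SECTION TWIN» (R312
junction), file (A). PROOF-ONLY (0 defs, no instance, no new `Prop`).

abc-iut-L2-d3 g6's `Sec2HuuEigenSplitting` (p448848 ✓: `isMinusEigen_ofHuu`, `isSplitting_ofHuu`, `exists_inversion_ofHuu`)
sits on gen 4's `PiCData.coverDataAx … hx hIx …` (GEOMETRIC cusp datum) and on abc-iut-L2-t8's `C.CuspAdapted x`; hIx is FALSE
at every model carrying an `EtaleThetaData` (`not_hIx_modelχ'`). THIS file re-keys the three on gen 6's SECTION cover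
`PiCData.coverDataAxOfSection … s hsa …` (p449075 ✓; `Dx :=` the `D̄_x`-preimage `barTheta·incl(toHat(s G_K))` of a section
`s : G_K → Π^tp_Y` of `aug`) — every abc-iut-L2-d3 lemma about `H := cl(ιC(inclX(C.Huu)))` (p447270 ✓) consumed BY NAME:
* `isMinusEigen_ofHuuOfSection` — Prop. 2.2 (i): `E := H ∩ Δ_C` (their proof verbatim, `hT := isTypeLTors_ofSection`);
* `isSplitting_ofHuuOfSection` — Prop. 2.2 (ii): `S := H ∩ (D̄_x-preimage·Ker)` is a splitting, its surjectivity onto `G_K` now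
  from «`s(G_K) ⊆ Π^tp_{X̲̲}`» (`hsH`; at the χ-models: `inr_mem_Huuχ`) INSTEAD of `CuspAdapted`; `splitting_sup_eigen_eq_closureHuu_ofSection`;
* **`exists_inversion_ofHuuOfSection`** — Prop. 2.2 (iii) / Def. 2.3: an inversion `ι₀ ∈ Δ_C ∖ Π_X`, `ι₀² ∈ Ker`, normalising
  `H`, with `H·⟨ι₀⟩` of type `(1, l-torsΘ)±` and `H·⟨ι₀⟩ ∩ Π_X = H` (their route verbatim).
BINDERS: `op`, the section (`hsa`, `hsZ`, `hsH`), hιell (P-C4), hN (P-C7 ⟸ L02), `hK : barKerTp l ≤ C.Huu` (G-L2d3-7),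
`C.IotaStable (e.conjX g)` — NO hIx, NO cusp `x`, NO `CuspAdapted`. HONEST FRAMING: typed-interface statements; nothing asserts a
`MuTwoSetting` exists for a curve; [EtTh] is refereed; no side is taken on [IUTchIII] Cor. 3.12; typed ≠ proved elsewhere.
-/

noncomputable section

namespace Literature.AnabelianGeometry.EtaleTheta

open Literature.AnabelianGeometry.SemiGraphs ThetaCovers
open _root_.Topology

namespace MuTwoSetting.CLevelData

variable {p : ℕ} [Fact p.Prime] {M : MuTwoSetting p}
variable {PC : Type} [Group PC] [TopologicalSpace PC] [IsTopologicalGroup PC] [T2Space PC]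

section Binders

variable (e : M.CLevelData) (ιC : M.GtpC →ₜ* PC) (hιC : IsProfiniteCompletion ιC)
  (op : M.toThetaSetting.OncePuncturedData) {l : ℕ} (hodd : Odd l)
  (s : ↥M.GK →* M.PiTemp) (hsa : ∀ σ, M.aug (s σ) = (σ : GQp p)) (hsZ : ∀ σ, M.toZ (s σ) = 1)
  (hιell : ∀ c ∈ (e.piCDataOf ιC hιC).augGK.ker, c ∉ (e.piCDataOf ιC hιC).PiX →
    ∀ d ∈ (e.piCDataOf ιC hιC).PiX ⊓ (e.piCDataOf ιC hιC).augGK.ker,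
      c * d * c⁻¹ * d ∈ (e.piCDataOf ιC hιC).barTheta l)
  (hN : ((M.GtpXu l).map M.inclX).Normal)
  {E : M.toThetaSetting.EtaleThetaData} (C : E.DoubleUnderline l) (hK : M.barKerTp l ≤ C.Huu)

/-! ### Prop. 2.2 (i): `E := H ∩ Δ_C` is the `(−1)`-eigenspace for the section cover -/

include hN hK hsZ in
/-- **Prop. 2.2 (i) for the section cover: `E := H ∩ Δ_C` is abc-iut-L2-t2's `(−1)`-eigenspace datum** for any `ι ∈ Δ_C ∖ Π_X`
normalising `E` — abc-iut-L2-d3's `isMinusEigen_ofHuu` with the cover base swapped (`hT := isTypeLTors_ofSection`; the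
cover-generic lemmas `comm_of_mem` / `inv_ell` / `inv_theta` of gen 2–3 apply to any `CoverDataAx`).
[cite: MochizukiEtTh2009, Prop 2.2 (i) p.37] -/
theorem isMinusEigen_ofHuuOfSection (H' : Subgroup PC) {ι : PC} (hιΔ : ι ∈ (e.piCDataOf ιC hιC).augGK.ker)
    (hιX : ι ∉ (e.piCDataOf ιC hιC).PiX)
    (hιE : ∀ e' ∈ ((C.Huu.map M.inclX).map ιC.toMonoidHom).topologicalClosure ⊓ (e.piCDataOf ιC hιC).augGK.ker,
      ι * e' * ι⁻¹ ∈ ((C.Huu.map M.inclX).map ιC.toMonoidHom).topologicalClosure ⊓ (e.piCDataOf ιC hιC).augGK.ker) :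
    ((e.piCDataOf ιC hιC).coverDataAxOfSection l op hodd s hsa hιell
        ((e.piCDataOf ιC hιC).inv_theta_of_inv_ell l op hιell)).toCoverData.IsMinusEigen
      ((((M.GtpXu l).map M.inclX).map ιC.toMonoidHom).topologicalClosure) H' ι
      (((C.Huu.map M.inclX).map ιC.toMonoidHom).topologicalClosure ⊓ (e.piCDataOf ιC hιC).augGK.ker) := by
  haveI : NeZero l := ⟨by obtain ⟨k, hk⟩ := hodd; omega⟩
  set I := e.piCDataOf ιC hιC with hI
  set X := I.coverDataAxOfSection l op hodd s hsa hιell (I.inv_theta_of_inv_ell l op hιell) with hXdef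
  set H := ((C.Huu.map M.inclX).map ιC.toMonoidHom).topologicalClosure with hH
  set Xu := (((M.GtpXu l).map M.inclX).map ιC.toMonoidHom).topologicalClosure with hXu
  haveI : (I.barTheta l).Normal := I.barTheta_normal l op
  haveI : (I.barKer l).Normal := I.barKer_normal l op
  have hT : X.toCoverData.IsTypeLTors Xu := e.isTypeLTors_ofSection ιC hιC op hodd s hsa hιell hsZ
  have hHXu : H ≤ Xu := closureHuu_le_closureXu ιC C
  have hKH : I.barKer l ≤ H := e.barKer_le_closureHuu ιC hιC C op hK
  have hKΔ : I.barKer l ≤ I.augGK.ker := fun k hk => ((I.barKer_le_barTheta l op).trans (I.barTheta_le l op) hk).2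
  have hKE : I.barKer l ≤ H ⊓ I.augGK.ker := le_inf hKH hKΔ
  have hinf : H ⊓ I.augGK.ker ⊓ I.barTheta l = I.barKer l := by
    refine le_antisymm ?_ (le_inf hKE (I.barKer_le_barTheta l op))
    exact (inf_le_inf_right _ inf_le_left).trans (e.closureHuu_inf_barTheta_le_barKer ιC hιC C op hK)
  -- `E · barTheta = Δ_X̲` by index counting
  have hsup : (H ⊓ I.augGK.ker) ⊔ I.barTheta l = Xu ⊓ I.augGK.ker := by
    have hEΔ : H ⊓ I.augGK.ker ≤ Xu ⊓ I.augGK.ker := inf_le_inf_right _ hHXu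
    have hΘΔ : I.barTheta l ≤ Xu ⊓ I.augGK.ker := le_inf hT.barTheta_le fun t ht => (I.barTheta_le l op ht).2
    have hFΔ : (H ⊓ I.augGK.ker) ⊔ I.barTheta l ≤ Xu ⊓ I.augGK.ker := sup_le hEΔ hΘΔ
    have h1 : (H ⊓ I.augGK.ker).relIndex ((H ⊓ I.augGK.ker) ⊔ I.barTheta l) = l := by
      rw [CoverData.relIndex_sup_eq_relIndex_of_normal, ← Subgroup.inf_relIndex_right, hinf]
      exact I.relIndex_barKer l op hodd
    have h2 := Subgroup.relIndex_mul_relIndex (H ⊓ I.augGK.ker) _ _ le_sup_left hFΔ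
    rw [h1, e.relIndex_eigen_ofHuu ιC hιC hN C] at h2
    have h3 : ((H ⊓ I.augGK.ker) ⊔ I.barTheta l).relIndex (Xu ⊓ I.augGK.ker) = 1 := by
      have hl : l ≠ 0 := NeZero.ne l
      have h2' : l * ((H ⊓ I.augGK.ker) ⊔ I.barTheta l).relIndex (Xu ⊓ I.augGK.ker) = l * 1 := by
        rw [mul_one]; exact h2
      exact Nat.eq_of_mul_eq_mul_left (Nat.pos_of_ne_zero hl) h2'
    exact le_antisymm hFΔ (Subgroup.relIndex_eq_one.1 h3)
  refine
    { barKer_le := hKE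
      le := inf_le_inf_right _ hHXu
      conj_mem := ?_
      inf_eq := hinf
      sup_eq := hsup
      minus := ?_
      plus := fun t ht => X.inv_theta ι hιΔ hιX t ht
      iota_conj := hιE }
  · -- `Π_X̲`-stability: `g = h·d`, `h ∈ H`, `d ∈ Δ_X̲`; `d e d⁻¹ = [d,e]·e ∈ Ker·E`
    show ∀ g ∈ Xu, ∀ e' ∈ H ⊓ I.augGK.ker, g * e' * g⁻¹ ∈ H ⊓ I.augGK.ker
    intro g hg e' he'
    obtain ⟨h, hh, d, hd, rfl⟩ := e.exists_closureHuu_mul_delta_eq ιC hιC C hg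
    have he'Xu : e' ∈ Xu := hHXu he'.1
    have he'Δ : e' ∈ X.DeltaX := ⟨e.closureXu_le_PiX ιC hιC l he'Xu, he'.2⟩
    have hdΔ : d ∈ X.DeltaX := ⟨e.closureXu_le_PiX ιC hιC l hd.1, hd.2⟩
    have hcomm : d * e' * d⁻¹ * e'⁻¹ ∈ I.barKer l := X.comm_of_mem hT hd.1 hdΔ he'Xu he'Δ
    have hde : d * e' * d⁻¹ ∈ H ⊓ I.augGK.ker := by
      have : d * e' * d⁻¹ = (d * e' * d⁻¹ * e'⁻¹) * e' := by group
      rw [this]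
      exact Subgroup.mul_mem _ (hKE hcomm) he'
    have : h * d * e' * (h * d)⁻¹ = h * (d * e' * d⁻¹) * h⁻¹ := by group
    rw [this]
    exact ⟨Subgroup.mul_mem _ (Subgroup.mul_mem _ hh hde.1) (Subgroup.inv_mem _ hh),
      (MonoidHom.normal_ker _).conj_mem _ hde.2 h⟩
  · -- `ι ≡ −1` on `E/Ker`: `ι e ι⁻¹ e ∈ E ∩ barTheta = Ker`
    show ∀ e' ∈ H ⊓ I.augGK.ker, ι * e' * ι⁻¹ * e' ∈ I.barKer l
    intro e' he'
    have he'Δ : e' ∈ X.PiX ⊓ X.aug.ker := ⟨e.closureXu_le_PiX ιC hιC l (hHXu he'.1), he'.2⟩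
    have h1 : ι * e' * ι⁻¹ * e' ∈ I.barTheta l := X.inv_ell ι hιΔ hιX e' he'Δ
    have h2 : ι * e' * ι⁻¹ * e' ∈ H ⊓ I.augGK.ker := Subgroup.mul_mem _ (hιE e' he') he'
    rw [← hinf]
    exact ⟨h2, h1⟩

/-! ### Prop. 2.2 (ii): the splitting `S := H ∩ (D̄_x-preimage·Ker)` from «`s(G_K) ⊆ Π^tp_{X̲̲}`» -/

/-- The section's image lies in `H` when `s` is valued in `Π^tp_{X̲̲}` (`incl(toHat(s σ)) = ιC(inclX(s σ))`).
[cite: MochizukiEtTh2009, Def 2.3 p.38] -/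
theorem incl_toHat_section_mem_closureHuu (hsH : ∀ σ, s σ ∈ C.Huu) (σ : ↥M.GK) :
    (e.piCDataOf ιC hιC).incl (M.toHat (s σ)) ∈ ((C.Huu.map M.inclX).map ιC.toMonoidHom).topologicalClosure := by
  rw [e.piCDataOf_incl_toHat ιC hιC (s σ)]
  exact Subgroup.le_topologicalClosure _ ⟨M.inclX (s σ), ⟨s σ, hsH σ, rfl⟩, rfl⟩

include hK in
/-- **Prop. 2.2 (ii) for the section cover: `S := H ∩ (D̄_x-preimage·Ker)` IS a splitting of `D̄_x ↠ G_K`**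
(`Ker ≤ S ≤ D_x·Ker`, `S ∩ Δ̄_Θ-preimage = Ker` — abc-iut-L2-d3's two clauses from `hK` —, `S ↠ G_K` from «`s(G_K) ⊆ Π^tp_{X̲̲}`»
in place of `CuspAdapted`). [cite: MochizukiEtTh2009, Prop 2.2 (ii) p.37] -/
theorem isSplitting_ofHuuOfSection (hsH : ∀ σ, s σ ∈ C.Huu) :
    ((e.piCDataOf ιC hιC).coverDataAxOfSection l op hodd s hsa hιell
        ((e.piCDataOf ιC hιC).inv_theta_of_inv_ell l op hιell)).toCoverData.IsSplitting
      (((C.Huu.map M.inclX).map ιC.toMonoidHom).topologicalClosure ⊓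
        ((e.piCDataOf ιC hιC).sectionDx l s ⊔ (e.piCDataOf ιC hιC).barKer l)) := by
  set I := e.piCDataOf ιC hιC with hI
  set H := ((C.Huu.map M.inclX).map ιC.toMonoidHom).topologicalClosure with hH
  have hKH : I.barKer l ≤ H := e.barKer_le_closureHuu ιC hιC C op hK
  refine
    { barKer_le := le_inf hKH le_sup_right
      le := inf_le_right
      inf_eq := ?_
      surj := ?_ }
  · refine le_antisymm ?_ (le_inf (le_inf hKH le_sup_right) (I.barKer_le_barTheta l op))
    exact (inf_le_inf_right _ inf_le_left).trans (e.closureHuu_inf_barTheta_le_barKer ιC hιC C op hK)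
  · rintro (σ : ↥M.GK)
    refine ⟨⟨I.incl (M.toHat (s σ)), e.incl_toHat_section_mem_closureHuu ιC hιC s C hsH σ,
      Subgroup.mem_sup_left (Subgroup.mem_sup_right (I.incl_toHat_section_mem s σ))⟩, Subtype.ext ?_⟩
    show ((I.augGK (I.incl (M.toHat (s σ))) : M.GK) : GQp p) = (σ : GQp p)
    rw [ThetaSetting.PiCData.coe_augGK_apply, I.aug_incl_toHat_section s hsa]

include hsa in
/-- **`S·E = H`** for the section splitting (`S ↠ G_K` through `s(G_K) ⊆ H` and `E = H ∩ Δ_C`).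
[cite: MochizukiEtTh2009, Def 2.3 p.38] -/
theorem splitting_sup_eigen_eq_closureHuu_ofSection (hsH : ∀ σ, s σ ∈ C.Huu) :
    (((C.Huu.map M.inclX).map ιC.toMonoidHom).topologicalClosure ⊓
        ((e.piCDataOf ιC hιC).sectionDx l s ⊔ (e.piCDataOf ιC hιC).barKer l)) ⊔
      (((C.Huu.map M.inclX).map ιC.toMonoidHom).topologicalClosure ⊓ (e.piCDataOf ιC hιC).augGK.ker) =
      ((C.Huu.map M.inclX).map ιC.toMonoidHom).topologicalClosure := by
  set I := e.piCDataOf ιC hιC with hI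
  set H := ((C.Huu.map M.inclX).map ιC.toMonoidHom).topologicalClosure with hH
  refine le_antisymm (sup_le inf_le_left inf_le_left) fun h hh => ?_
  set y : PC := I.incl (M.toHat (s (I.augGK h))) with hy
  have hyH : y ∈ H := e.incl_toHat_section_mem_closureHuu ιC hιC s C hsH _
  have hyD : y ∈ I.sectionDx l s ⊔ I.barKer l := Subgroup.mem_sup_left (Subgroup.mem_sup_right (I.incl_toHat_section_mem s _))
  have hya : I.aug y = I.aug h := by
    rw [hy, I.aug_incl_toHat_section s hsa]
    exact (ThetaSetting.PiCData.coe_augGK_apply I h)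
  have hmem : h * y⁻¹ ∈ H ⊓ I.augGK.ker := by
    refine Subgroup.mem_inf.2 ⟨Subgroup.mul_mem _ hh (Subgroup.inv_mem _ hyH), ?_⟩
    rw [I.mem_ker_augGK, map_mul, map_inv, hya, mul_inv_cancel]
  have : h = (h * y⁻¹) * y := by group
  rw [this]
  exact Subgroup.mul_mem _ (Subgroup.mem_sup_right hmem) (Subgroup.mem_sup_left ⟨hyH, hyD⟩)

/-! ### Prop. 2.2 (iii) / Def. 2.3: an inversion of order `2` normalising `H`; `Π_{C̲̲} := H·⟨ι₀⟩` -/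

include hN hK hsZ in
/-- **Prop. 2.2 (iii) / Def. 2.3 for the section cover and the CHOSEN `X̲̲`**: granted `g ∈ Π^tp_C ∖ Π^tp_X` with
`C.IotaStable (e.conjX g)` and a section valued in `Π^tp_Y ∩ Π^tp_{X̲̲}`, there is an inversion `ι₀ ∈ Δ_C ∖ Π_X` with `ι₀² ∈ Ker`
normalising `H`, such that `Π_{C̲̲} := H·⟨ι₀⟩` is of type `(1, l-torsΘ)±` and `Π_{C̲̲} ∩ Π_X = H` — abc-iut-L2-d3's
`exists_inversion_ofHuu` route verbatim on the section base (NO hIx, NO cusp, NO `CuspAdapted`).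
[cite: MochizukiEtTh2009, Prop 2.2 (iii) p.37] -/
theorem exists_inversion_ofHuuOfSection {g : M.GtpC} (hgX : g ∉ M.inclX.range) (hι : C.IotaStable (e.conjX g))
    (hsH : ∀ σ, s σ ∈ C.Huu) :
    ∃ ι₀ : PC,
      ((e.piCDataOf ιC hιC).coverDataAxOfSection l op hodd s hsa hιell
          ((e.piCDataOf ιC hιC).inv_theta_of_inv_ell l op hιell)).toCoverData.IsTypeLTorsThetaPm
        (((C.Huu.map M.inclX).map ιC.toMonoidHom).topologicalClosure ⊔ Subgroup.zpowers ι₀) ∧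
      (((C.Huu.map M.inclX).map ιC.toMonoidHom).topologicalClosure ⊔ Subgroup.zpowers ι₀) ⊓
          (e.piCDataOf ιC hιC).PiX = ((C.Huu.map M.inclX).map ιC.toMonoidHom).topologicalClosure ∧
      ι₀ ∈ (e.piCDataOf ιC hιC).augGK.ker ∧ ι₀ ∉ (e.piCDataOf ιC hιC).PiX ∧
      ι₀ * ι₀ ∈ (e.piCDataOf ιC hιC).barKer l ∧
      ∀ h ∈ ((C.Huu.map M.inclX).map ιC.toMonoidHom).topologicalClosure,
        ι₀ * h * ι₀⁻¹ ∈ ((C.Huu.map M.inclX).map ιC.toMonoidHom).topologicalClosure := by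
  haveI : NeZero l := ⟨by obtain ⟨k, hk⟩ := hodd; omega⟩
  set I := e.piCDataOf ιC hιC with hI
  set X := I.coverDataAxOfSection l op hodd s hsa hιell (I.inv_theta_of_inv_ell l op hιell) with hXdef
  set H := ((C.Huu.map M.inclX).map ιC.toMonoidHom).topologicalClosure with hH
  set Xu := (((M.GtpXu l).map M.inclX).map ιC.toMonoidHom).topologicalClosure with hXu
  haveI : Xu.Normal := closureXu_normal ιC hιC l hN
  haveI := I.range_normal
  have hHXu : H ≤ Xu := closureHuu_le_closureXu ιC C
  have hXuX : Xu ≤ I.PiX := e.closureXu_le_PiX ιC hιC l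
  -- (1) correct `g` into `Δ_C`: `c := ιC (g · inclX y)`, `y ∈ Π^tp_{X̲̲}`, `aug y = (augC g)⁻¹`
  have hγ : (e.augC g)⁻¹ ∈ C.Huu.map M.aug.toMonoidHom := by
    rw [C.map_aug_Huu]
    exact Subgroup.inv_mem _ (e.augC_mem_GK g)
  obtain ⟨y, hy, hyγ⟩ := hγ
  set c : PC := ιC (g * M.inclX y) with hc
  have hcΔ : c ∈ I.augGK.ker := by
    rw [I.mem_ker_augGK, hc, e.piCDataOf_aug_apply, map_mul, e.augC_inclX]
    change e.augC g * M.aug.toMonoidHom y = 1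
    rw [hyγ, mul_inv_cancel]
  have hcX : c ∉ I.PiX := by
    intro h
    have h' := (mem_range_hatInclX_iff ιC hιC I.incl (e.piCDataOf_incl_toHat ιC hιC) _).1 h
    have : g ∈ M.inclX.range := by
      have h'' := Subgroup.mul_mem _ h' (Subgroup.inv_mem _ (⟨y, rfl⟩ : M.inclX y ∈ M.inclX.range))
      rwa [mul_inv_cancel_right] at h''
    exact hgX this
  have hι' : C.IotaStable (e.conjX (g * M.inclX y)) := by
    refine ThetaSetting.EtaleThetaData.DoubleUnderline.IotaStable.of_mem_iff fun z => ?_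
    have hz : e.conjX (g * M.inclX y) z = e.conjX g (y * z * y⁻¹) := by
      apply M.injective_inclX
      rw [e.inclX_conjX, e.inclX_conjX]
      simp only [map_mul, map_inv]
      group
    rw [hz, hι.mem_iff]
    constructor
    · intro h
      have := C.Huu.mul_mem (C.Huu.mul_mem (C.Huu.inv_mem hy) h) hy
      rwa [← mul_assoc, ← mul_assoc, inv_mul_cancel, one_mul, inv_mul_cancel_right] at this
    · intro h
      exact C.Huu.mul_mem (C.Huu.mul_mem hy h) (C.Huu.inv_mem hy)
  have hcH : ∀ h ∈ H, c * h * c⁻¹ ∈ H := fun h hh => e.conj_mem_closureHuu ιC C hι' hh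
  -- (2) `Π_C̲ := Π_X̲·⟨c⟩`, the eigenspace, the splitting
  set H' := Xu ⊔ Subgroup.zpowers c with hH'
  have hTPm : X.toCoverData.IsTypeLTorsPm H' :=
    e.isTypeLTorsPm_ofSection ιC hιC op hodd s hsa hιell hsZ hN hcΔ hcX
  have hXuH' : Xu = H' ⊓ X.PiX :=
    (sup_zpowers_inf_eq_of_sq_mem hXuX (e.sq_mem_closureXu_of_inv_ell ιC hιC op hodd hιell hcΔ hcX) hcX).symm
  have hιc : X.toCoverData.IsInversion H' c := e.isInversion_ofSection ιC hιC op hodd s hsa hιell hcΔ hcX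
  have hEc : X.toCoverData.IsMinusEigen Xu H' c (H ⊓ I.augGK.ker) :=
    e.isMinusEigen_ofHuuOfSection ιC hιC op hodd s hsa hsZ hιell hN C hK H' hcΔ hcX fun e' he' =>
      ⟨hcH e' he'.1, (MonoidHom.normal_ker _).conj_mem _ he'.2 c⟩
  have hS := e.isSplitting_ofHuuOfSection ιC hιC op hodd s hsa hιell C hK hsH
  have hSE := e.splitting_sup_eigen_eq_closureHuu_ofSection ιC hιC s hsa C hsH
  -- (3) the inversion of order `2` (Prop. 2.2 (iii))
  have hex : ∃ ι₀ : PC, X.toCoverData.IsInversion H' ι₀ ∧ ι₀ * ι₀ ∈ I.barKer l := by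
    obtain ⟨ι₀, hι₀, h2, -⟩ := (X.prop22_iii_holds Xu H' _ _ c hTPm hXuH' hιc hEc hS).1
    exact ⟨ι₀, hι₀, h2⟩
  obtain ⟨ι₀, hι₀, h2⟩ := hex
  have hι₀Δ : ι₀ ∈ I.augGK.ker := hι₀.mem_delta
  have hι₀X : ι₀ ∉ I.PiX := hι₀.not_mem
  have hd : c⁻¹ * ι₀ ∈ Xu ⊓ I.augGK.ker := by
    refine Subgroup.mem_inf.2 ⟨?_, Subgroup.mul_mem _ (Subgroup.inv_mem _ hcΔ) hι₀Δ⟩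
    rw [hXuH']
    refine Subgroup.mem_inf.2 ⟨Subgroup.mul_mem _ (Subgroup.inv_mem _ hιc.mem) hι₀.mem, ?_⟩
    exact (Subgroup.mul_mem_iff_of_index_two I.index_range).2
      (iff_of_false (fun h => hcX (inv_mem_iff.1 h)) hι₀X)
  have hι₀E : ∀ e' ∈ H ⊓ I.augGK.ker, ι₀ * e' * ι₀⁻¹ ∈ H ⊓ I.augGK.ker := by
    intro e' he'
    have h1 := hEc.conj_mem (c⁻¹ * ι₀) hd.1 e' he'
    have h2' : c * (c⁻¹ * ι₀ * e' * (c⁻¹ * ι₀)⁻¹) * c⁻¹ = ι₀ * e' * ι₀⁻¹ := by group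
    rw [← h2']
    exact ⟨hcH _ h1.1, (MonoidHom.normal_ker _).conj_mem _ h1.2 c⟩
  have hE₀ : X.toCoverData.IsMinusEigen Xu H' ι₀ (H ⊓ I.augGK.ker) :=
    e.isMinusEigen_ofHuuOfSection ιC hιC op hodd s hsa hsZ hιell hN C hK H' hι₀Δ hι₀X hι₀E
  have hE₀' : X.toCoverData.IsMinusEigen (H' ⊓ X.PiX) H' ι₀ (H ⊓ I.augGK.ker) := by
    rw [show (H' ⊓ X.PiX : Subgroup X.PiC) = Xu from hXuH'.symm]
    exact hE₀
  -- (4) conclusions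
  have hnorm : ∀ h ∈ H, ι₀ * h * ι₀⁻¹ ∈ H := fun h hh =>
    hSE.le (X.inversion_conj_mem_sup hTPm hXuH' hι₀ hE₀ hS h2 (hSE.ge hh))
  have hle : H ⊔ Subgroup.zpowers ι₀ ≤ H' :=
    sup_le (hHXu.trans le_sup_left) ((Subgroup.zpowers_le).2 hι₀.mem)
  have hkey := X.sup_zpowers_inf_eq hTPm hXuH' hι₀ hE₀ hS h2
  refine ⟨ι₀, ⟨⟨H', _, _, ι₀, hTPm, hι₀, h2, hE₀', hS,
    congrArg (fun K : Subgroup PC => K ⊔ Subgroup.zpowers ι₀) hSE.symm⟩⟩, ?_, hι₀Δ, hι₀X, h2, hnorm⟩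
  refine le_antisymm ?_ (le_inf le_sup_left (hHXu.trans hXuX))
  rintro z ⟨hz1, hz2⟩
  have hzXu : z ∈ Xu := by
    rw [hXuH']
    exact Subgroup.mem_inf.2 ⟨hle hz1, hz2⟩
  have hz1' := (sup_le_sup_right hSE.ge (Subgroup.zpowers ι₀)) hz1
  exact hSE.le (hkey.le (Subgroup.mem_inf.2 ⟨hz1', hzXu⟩))

end Binders

end MuTwoSetting.CLevelData

end Literature.AnabelianGeometry.EtaleTheta

end
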